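import Summits.KontsevichZagierPeriods.KontsevichZagierPeriods.Theorems.FurushoPentagonKernelModuloPeriodConjectureLeafOfOddDetSum
import HarnessLib

/-!
# Crux `LinRedNormalForm.HoffmanSpanInKZ` (stmt-KontsevichZagierPeriods-15044), line `eds-ds`:
# the Hoffman expansion from an odd determinant, for ANY class of solutions (generic cores E10/G2)

Line `eds-ds` (lead c3). The two cores of the soundness chain of the GF(2) rank engine `LinEDS`
(route FurushoPentagon, crux stmt-15058: `stub_leaf_of_oddDet`, `stub_leaf_of_oddDetSum`) conclude the
Hoffman expansion of `c_{bw s}` at every group-like PENTAGON solution, the pentagon entering only through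
E5 (the integer EDS rows vanish there). Here the same two theorems are proved with that step ABSTRACTED:
the expansion holds at every group-like series `φ` over a commutative `ℚ`-algebra with `c_y(φ) = 0` ON
WHICH THE VALID ROWS OF WEIGHT `k` VANISH (`∀ nm, validName k nm → evalZ φ (rowZ nm) = 0`). The
pentagon leaf is the instance E5 (`stub_eval_rowZ_divFold`); the double-shuffle leaf `LeafDS` of this
line is the instance E5′ (`stub_rowZ_of_gds`, `…EdsDSRows`); no reducedness is needed. Proofs are those
of the FurushoPentagon cores verbatim (linear algebra over `ℚ`: odd determinant ⇒ invertible over `ℚ` ⇒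
the column word's coefficient is a fixed rational combination of the folded rows; E8 `stub_cols_spec`,
E9 `stub_rowBits_parity` / `stub_rowZ_support_shape`, fold soundness `stub_eval_rowZ_divFold.2`).

* `leafRows_of_isHoffman` — a Hoffman index reduces to itself;
* `stub_leafRows_of_oddDet` — plain rows, any finite indexing (registered stub);
* `stub_leafRows_of_oddDetSum` — grouped (summed) rows (registered stub).

References: K. Ihara, M. Kaneko, D. Zagier, Compos. Math. 142 (2006) §2 [IharaKanekoZagier2006];
M. E. Hoffman, J. Algebra 194 (1997) [Hoffman1997].
-/

namespace Summit.KontsevichZagierPeriods.LinRedNormalForm.HoffmanSpanInKZ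

open Literature.NumberTheory.Transcendental
open Literature.NumberTheory.Transcendental.LinEDS
open Summit.KontsevichZagierPeriods.FurushoPentagon.KernelModuloPeriodConjecture

/-- **A Hoffman index reduces to itself** (`b = single s 1`), at every series whatsoever. [folklore] -/
theorem leafRows_of_isHoffman (k : ℕ) {s : List ℕ} (hs : MZV.IsHoffman s) :
    ∃ b : List ℕ →₀ ℚ, (∀ t ∈ b.support, MZV.IsHoffman t ∧ MZV.weight t = MZV.weight s) ∧ ∀ (R : Type) [CommRing R] [Algebra ℚ R] (φ : NCSeries Bool R), NCSeries.IsGroupLike φ → φ [true] = 0 → (∀ nm : List ℕ × List ℕ, LinEDS.validName k nm = true → LinEDS.evalZ φ (LinEDS.rowZ nm) = 0) → φ (MZV.binaryWord s) = b.sum (fun t q => q • φ (MZV.binaryWord t)) := by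
  refine ⟨Finsupp.single s 1, fun t ht => ?_, fun R _ _ φ _ _ _ => ?_⟩
  · rw [leafLowWeight_eq_of_mem_support_single ht]; exact ⟨hs, rfl⟩
  · rw [leafLowWeight_sum_single, one_smul]

/-- **The Hoffman expansion from an odd determinant, generic in the solution class** (registered
stub `stub_leafRows_of_oddDet` of line `eds-ds`, crux stmt-KontsevichZagierPeriods-15044; the
FurushoPentagon core `stub_leaf_of_oddDet` with E5 abstracted): valid row names and columns of weight `k`
indexed by any finite type, columns hitting every column of the engine, odd determinant of the
integer relation matrix ⇒ the Hoffman expansion of every admissible index of weight `k` at every group-like series with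
`c_y = 0` on which the valid rows vanish.
[cite: IharaKanekoZagier2006, Conjecture 1] -/
theorem stub_leafRows_of_oddDet :
    ∀ (k : ℕ) (ι : Type) [Fintype ι] [DecidableEq ι] (ν : ι → List ℕ × List ℕ) (col : ι → ℕ),
      2 ≤ k → (∀ i, LinEDS.validName k (ν i) = true) → (∀ j, col j ∈ LinEDS.cols k) →
      (∀ c ∈ LinEDS.cols k, ∃ j, col j = c) →
      Odd (Matrix.of fun i j => LinEDS.entry k (ν i) (col j)).det →
      ∀ s : List ℕ, MZV.IsAdmissible s → MZV.weight s = k →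
        ∃ b : List ℕ →₀ ℚ, (∀ t ∈ b.support, MZV.IsHoffman t ∧ MZV.weight t = MZV.weight s) ∧ ∀ (R : Type) [CommRing R] [Algebra ℚ R] (φ : NCSeries Bool R), NCSeries.IsGroupLike φ → φ [true] = 0 → (∀ nm : List ℕ × List ℕ, LinEDS.validName k nm = true → LinEDS.evalZ φ (LinEDS.rowZ nm) = 0) → φ (MZV.binaryWord s) = b.sum (fun t q => q • φ (MZV.binaryWord t)) := by
  classical
  intro k ι _ _ ν col hk2 hvalid hcolmem hcolsurj hdet s hs hw
  by_cases hH : MZV.IsHoffman s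
  · exact leafRows_of_isHoffman k hH
  have hs0 : s ≠ [] := by rintro rfl; exact hH fun i hi => by simp at hi
  obtain ⟨a, s', rfl⟩ := List.exists_cons_of_ne_nil hs0
  obtain ⟨hpw, hcols, hhof, -⟩ := stub_cols_spec k hk2
  -- the column of `s`
  set c₀ := LinEDS.code (MZV.binaryWord (a :: s')) with hc₀
  have hwlen : (MZV.binaryWord (a :: s')).length = k := by rw [MZV.length_binaryWord hs.1, hw]
  obtain ⟨hc₀lt, hc₀odd⟩ := masterE10_code_binaryWord hs hs0
  rw [hw] at hc₀lt
  have hwc₀ : LinEDS.wordOfCode k c₀ = MZV.binaryWord (a :: s') := by rw [hc₀, ← hwlen, wordOfCode_code]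
  have hc₀col : c₀ ∈ LinEDS.cols k := by
    refine (hcols c₀).mpr ⟨hc₀lt, hc₀odd, ?_⟩
    rintro ⟨t, ht, htw⟩
    rw [hwc₀] at htw
    have hpos : ∀ i ∈ t, 1 ≤ i := fun i hi => by rcases ht i hi with rfl | rfl <;> omega
    have := congrArg MZV.ofBinaryWord htw
    rw [MZV.ofBinaryWord_binaryWord hpos, MZV.ofBinaryWord_binaryWord hs.1] at this
    subst this
    exact hH ht
  set A : Matrix ι ι ℤ := Matrix.of fun i j => LinEDS.entry k (ν i) (col j) with hA
  have hinj := oddDetE11_col_injective ν col hdet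
  obtain ⟨j₀, hcolj₀⟩ := hcolsurj c₀ hc₀col
  obtain ⟨l, hl⟩ := oddDetE11_solve A hdet j₀
  -- the folded integer rows and their coefficients
  let g : ι → (List Bool →₀ ℤ) := fun i => LinEDS.divFold (LinEDS.rowZ (ν i))
  let coef : List Bool → ℚ := fun w => ∑ i, l i * (g i w : ℚ)
  have hcoef_col : ∀ j, coef (LinEDS.wordOfCode k (col j)) = if j = j₀ then 1 else 0 := fun j => by
    rw [← hl j]; rfl
  have hcoef_cols : ∀ c ∈ LinEDS.cols k, coef (LinEDS.wordOfCode k c) = if c = c₀ then 1 else 0 := by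
    intro c hc
    obtain ⟨j, rfl⟩ := hcolsurj c hc
    rw [hcoef_col]
    by_cases hj : j = j₀
    · subst hj; simp [hcolj₀]
    · rw [if_neg hj, if_neg]
      intro h; exact hj (hinj (h.trans hcolj₀.symm))
  -- the answer
  let T : Finset (List ℕ) := (LinEDS.hofLists k).toFinset
  refine ⟨∑ t ∈ T, Finsupp.single t (-coef (MZV.binaryWord t)), fun t ht => ?_,
    fun R _ _ φ hg h1 hrows => ?_⟩
  · -- support
    have ht' : t ∈ T := by
      by_contra hnot
      rw [Finsupp.mem_support_iff, Finsupp.finsetSum_apply] at ht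
      exact ht (Finset.sum_eq_zero fun t' ht'' => Finsupp.single_eq_of_ne fun h => hnot (h ▸ ht''))
    obtain ⟨hH', hwt⟩ := (hhof t).mp (List.mem_toFinset.mp ht')
    exact ⟨hH', by rw [hwt, hw]⟩
  · -- the identity at a group-like series killing `y` on which the rows vanish
    -- every folded row evaluates to zero
    have hev : ∀ i, LinEDS.evalZ φ (g i) = 0 := fun i => by
      show LinEDS.evalZ φ (LinEDS.divFold (LinEDS.rowZ (ν i))) = 0
      rw [stub_eval_rowZ_divFold.2 R φ hg h1 _ (fun w hw =>
        (stub_rowZ_support_shape k _ (hvalid i) w hw).2.1)]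
      exact hrows _ (hvalid i)
    -- the common finite set of words: column words and Hoffman words
    let Wc : Finset (List Bool) := ((LinEDS.cols k).map (LinEDS.wordOfCode k)).toFinset
    let Wh : Finset (List Bool) := T.image MZV.binaryWord
    have hsupp : ∀ i, (g i).support ⊆ Wc ∪ Wh := by
      intro i w hw
      obtain ⟨hwl, hwh, hwlast⟩ := (stub_rowBits_parity k _ (hvalid i)).2.2 w hw
      have hne : w ≠ [] := by rintro rfl; simp at hwh
      -- admissible code
      have hcodelt : LinEDS.code w < 2 ^ (k - 1) := by
        rw [List.eq_cons_of_mem_head? hwh, code_cons]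
        simp only [Bool.toNat_false, zero_mul, zero_add]
        have := code_lt w.tail
        rwa [List.length_tail, hwl] at this
      have hcodeodd : LinEDS.code w % 2 = 1 := by
        have h0 : (LinEDS.code w).testBit 0 = true := by
          rw [testBit_code]
          obtain ⟨w', hw'⟩ := List.getLast?_eq_some_iff.mp hwlast
          rw [hw']; simp
        simpa using h0
      have hww : LinEDS.wordOfCode k (LinEDS.code w) = w := by rw [← hwl, wordOfCode_code]
      by_cases hcw : LinEDS.code w ∈ LinEDS.cols k
      · exact Finset.mem_union_left _ (List.mem_toFinset.mpr
          (List.mem_map.mpr ⟨_, hcw, hww⟩))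
      · have : ∃ t, MZV.IsHoffman t ∧ MZV.binaryWord t = LinEDS.wordOfCode k (LinEDS.code w) := by
          by_contra hno
          exact hcw ((hcols _).mpr ⟨hcodelt, hcodeodd, hno⟩)
        obtain ⟨t, ht, htw⟩ := this
        rw [hww] at htw
        refine Finset.mem_union_right _ (Finset.mem_image.mpr ⟨t, List.mem_toFinset.mpr ?_, htw⟩)
        refine (hhof t).mpr ⟨ht, ?_⟩
        have hpos : ∀ i ∈ t, 1 ≤ i := fun i hi => by rcases ht i hi with rfl | rfl <;> omega
        rw [← MZV.length_binaryWord hpos, htw, hwl]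
    have hdisj : Disjoint Wc Wh := by
      rw [Finset.disjoint_left]
      intro w hwc hwh
      obtain ⟨c, hc, rfl⟩ := List.mem_map.mp (List.mem_toFinset.mp hwc)
      obtain ⟨t, ht, htw⟩ := Finset.mem_image.mp hwh
      exact ((hcols c).mp hc).2.2 ⟨t, ((hhof t).mp (List.mem_toFinset.mp ht)).1, htw⟩
    -- evaluation of each folded row as a sum over the common set, with rational scalars
    have hevsum : ∀ i, LinEDS.evalZ φ (g i) = ∑ w ∈ Wc ∪ Wh, ((g i w : ℤ) : ℚ) • φ w := by
      intro i
      unfold LinEDS.evalZ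
      refine (Finsupp.sum_of_support_subset (g i) (hsupp i) (fun w n => n • φ w)
        (fun w _ => zero_smul ℤ (φ w))).trans ?_
      exact Finset.sum_congr rfl fun w _ => (Int.cast_smul_eq_zsmul ℚ _ _).symm
    -- combine with the rational coefficients `l`
    have hzero : ∑ w ∈ Wc ∪ Wh, coef w • φ w = 0 := by
      have : ∑ i, l i • LinEDS.evalZ φ (g i) = 0 := Finset.sum_eq_zero fun i _ => by
        rw [hev i, smul_zero]
      rw [← this]
      simp_rw [hevsum, Finset.smul_sum, smul_smul]
      rw [Finset.sum_comm]
      exact Finset.sum_congr rfl fun w _ => by rw [← Finset.sum_smul]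
    rw [Finset.sum_union hdisj] at hzero
    -- the column part is `φ (bw s)`
    have hcolpart : ∑ w ∈ Wc, coef w • φ w = φ (MZV.binaryWord (a :: s')) := by
      have hnd : (LinEDS.cols k).Nodup := hpw.imp fun {x y} (h : x < y) => ne_of_lt h
      have hcodeinj : ∀ x ∈ LinEDS.cols k, ∀ y ∈ LinEDS.cols k,
          LinEDS.wordOfCode k x = LinEDS.wordOfCode k y → x = y := by
        intro x hx y hy hxy
        have hx' := ((hcols x).mp hx).1
        have hy' := ((hcols y).mp hy).1
        have := congrArg LinEDS.code hxy
        rwa [code_wordOfCode (lt_of_lt_of_le hx' (Nat.pow_le_pow_right (by norm_num) (by omega))),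
          code_wordOfCode (lt_of_lt_of_le hy' (Nat.pow_le_pow_right (by norm_num) (by omega)))] at this
      have hWc : Wc = (LinEDS.cols k).toFinset.image (LinEDS.wordOfCode k) := by
        ext w; simp [Wc, List.mem_toFinset]
      rw [hWc, Finset.sum_image (fun x hx y hy h => hcodeinj x (List.mem_toFinset.mp hx) y
        (List.mem_toFinset.mp hy) h)]
      rw [Finset.sum_congr rfl (g := fun c => if c = c₀ then φ (LinEDS.wordOfCode k c₀) else 0)
        (fun c hc => by
          rw [hcoef_cols c (List.mem_toFinset.mp hc)]
          by_cases h : c = c₀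
          · subst h; simp
          · simp [h]),
        Finset.sum_ite_eq', if_pos (List.mem_toFinset.mpr hc₀col), hwc₀]
    -- the Hoffman part is the `b`-sum
    have hhofpart : ∑ w ∈ Wh, coef w • φ w = ∑ t ∈ T, coef (MZV.binaryWord t) • φ (MZV.binaryWord t) := by
      refine Finset.sum_image fun t ht t' ht' h => ?_
      have hpos : ∀ i ∈ t, 1 ≤ i := fun i hi => by
        rcases ((hhof t).mp (List.mem_toFinset.mp ht)).1 i hi with rfl | rfl <;> omega
      have hpos' : ∀ i ∈ t', 1 ≤ i := fun i hi => by
        rcases ((hhof t').mp (List.mem_toFinset.mp ht')).1 i hi with rfl | rfl <;> omega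
      have := congrArg MZV.ofBinaryWord h
      rwa [MZV.ofBinaryWord_binaryWord hpos, MZV.ofBinaryWord_binaryWord hpos'] at this
    rw [hcolpart, hhofpart] at hzero
    rw [masterE10_sum_finset_single T _ (fun t q => q • φ (MZV.binaryWord t)) (fun t => zero_smul ℚ _)
      (fun t a b => add_smul a b _)]
    simp_rw [neg_smul, Finset.sum_neg_distrib]
    rw [eq_neg_iff_add_eq_zero, hzero]

/-- **The Hoffman expansion from an odd determinant, grouped rows, generic in the solution class**
(registered stub `stub_leafRows_of_oddDetSum` of line `eds-ds`, crux stmt-KontsevichZagierPeriods-15044;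
the FurushoPentagon core `stub_leaf_of_oddDetSum` with E5 abstracted): lists of valid row names and columns of weight `k` indexed by any finite type,
columns hitting every column of the engine, odd determinant of the integer matrix whose row `i` is
the sum of the EDS rows named in `ν i` ⇒ the Hoffman expansion at every group-like series with `c_y = 0` on which the valid rows vanish.
[cite: IharaKanekoZagier2006, Conjecture 1] -/
theorem stub_leafRows_of_oddDetSum :
    ∀ (k : ℕ) (ι : Type) [Fintype ι] [DecidableEq ι] (ν : ι → List (List ℕ × List ℕ))
      (col : ι → ℕ), 2 ≤ k → (∀ i, ∀ μ ∈ ν i, LinEDS.validName k μ = true) →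
      (∀ j, col j ∈ LinEDS.cols k) → (∀ c ∈ LinEDS.cols k, ∃ j, col j = c) →
      Odd (Matrix.of fun i j => ((ν i).map fun μ => LinEDS.entry k μ (col j)).sum).det →
      ∀ s : List ℕ, MZV.IsAdmissible s → MZV.weight s = k →
        ∃ b : List ℕ →₀ ℚ, (∀ t ∈ b.support, MZV.IsHoffman t ∧ MZV.weight t = MZV.weight s) ∧ ∀ (R : Type) [CommRing R] [Algebra ℚ R] (φ : NCSeries Bool R), NCSeries.IsGroupLike φ → φ [true] = 0 → (∀ nm : List ℕ × List ℕ, LinEDS.validName k nm = true → LinEDS.evalZ φ (LinEDS.rowZ nm) = 0) → φ (MZV.binaryWord s) = b.sum (fun t q => q • φ (MZV.binaryWord t)) := by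
  classical
  intro k ι _ _ ν col hk2 hvalid hcolmem hcolsurj hdet s hs hw
  by_cases hH : MZV.IsHoffman s
  · exact leafRows_of_isHoffman k hH
  have hs0 : s ≠ [] := by rintro rfl; exact hH fun i hi => by simp at hi
  obtain ⟨a, s', rfl⟩ := List.exists_cons_of_ne_nil hs0
  obtain ⟨hpw, hcols, hhof, -⟩ := stub_cols_spec k hk2
  -- the column of `s`
  set c₀ := LinEDS.code (MZV.binaryWord (a :: s')) with hc₀
  have hwlen : (MZV.binaryWord (a :: s')).length = k := by rw [MZV.length_binaryWord hs.1, hw]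
  obtain ⟨hc₀lt, hc₀odd⟩ := masterE10_code_binaryWord hs hs0
  rw [hw] at hc₀lt
  have hwc₀ : LinEDS.wordOfCode k c₀ = MZV.binaryWord (a :: s') := by rw [hc₀, ← hwlen, wordOfCode_code]
  have hc₀col : c₀ ∈ LinEDS.cols k := by
    refine (hcols c₀).mpr ⟨hc₀lt, hc₀odd, ?_⟩
    rintro ⟨t, ht, htw⟩
    rw [hwc₀] at htw
    have hpos : ∀ i ∈ t, 1 ≤ i := fun i hi => by rcases ht i hi with rfl | rfl <;> omega
    have := congrArg MZV.ofBinaryWord htw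
    rw [MZV.ofBinaryWord_binaryWord hpos, MZV.ofBinaryWord_binaryWord hs.1] at this
    subst this
    exact hH ht
  have hinj : Function.Injective col :=
    oddDetSumG_col_injective (fun i c => ((ν i).map fun μ => LinEDS.entry k μ c).sum) col hdet
  obtain ⟨j₀, hcolj₀⟩ := hcolsurj c₀ hc₀col
  obtain ⟨l, hl⟩ := oddDetE11_solve _ hdet j₀
  -- the folded (grouped) integer rows and their coefficients
  let g : ι → (List Bool →₀ ℤ) := fun i => ((ν i).map fun μ => LinEDS.divFold (LinEDS.rowZ μ)).sum
  have hentry : ∀ i c, g i (LinEDS.wordOfCode k c) = ((ν i).map fun μ => LinEDS.entry k μ c).sum := by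
    intro i c
    show ((ν i).map fun μ => LinEDS.divFold (LinEDS.rowZ μ)).sum (LinEDS.wordOfCode k c) = _
    rw [oddDetSumG_list_sum_apply, List.map_map]
    rfl
  let coef : List Bool → ℚ := fun w => ∑ i, l i * (g i w : ℚ)
  have hcoef_col : ∀ j, coef (LinEDS.wordOfCode k (col j)) = if j = j₀ then 1 else 0 := fun j => by
    rw [← hl j]
    refine Finset.sum_congr rfl fun i _ => ?_
    rw [hentry, Matrix.of_apply]
  have hcoef_cols : ∀ c ∈ LinEDS.cols k, coef (LinEDS.wordOfCode k c) = if c = c₀ then 1 else 0 := by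
    intro c hc
    obtain ⟨j, rfl⟩ := hcolsurj c hc
    rw [hcoef_col]
    by_cases hj : j = j₀
    · subst hj; simp [hcolj₀]
    · rw [if_neg hj, if_neg]
      intro h; exact hj (hinj (h.trans hcolj₀.symm))
  -- the answer
  let T : Finset (List ℕ) := (LinEDS.hofLists k).toFinset
  refine ⟨∑ t ∈ T, Finsupp.single t (-coef (MZV.binaryWord t)), fun t ht => ?_,
    fun R _ _ φ hg h1 hrows => ?_⟩
  · -- support
    have ht' : t ∈ T := by
      by_contra hnot
      rw [Finsupp.mem_support_iff, Finsupp.finsetSum_apply] at ht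
      exact ht (Finset.sum_eq_zero fun t' ht'' => Finsupp.single_eq_of_ne fun h => hnot (h ▸ ht''))
    obtain ⟨hH', hwt⟩ := (hhof t).mp (List.mem_toFinset.mp ht')
    exact ⟨hH', by rw [hwt, hw]⟩
  · -- the identity at a group-like series killing `y` on which the rows vanish
    -- every folded row of a valid name evaluates to zero, hence so does every grouped row
    have hev1 : ∀ μ, LinEDS.validName k μ = true →
        LinEDS.evalZ φ (LinEDS.divFold (LinEDS.rowZ μ)) = 0 := fun μ hμ => by
      rw [stub_eval_rowZ_divFold.2 R φ hg h1 _ (fun w hw =>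
        (stub_rowZ_support_shape k _ hμ w hw).2.1)]
      exact hrows _ hμ
    have hev : ∀ i, LinEDS.evalZ φ (g i) = 0 := fun i => by
      show LinEDS.evalZ φ ((ν i).map fun μ => LinEDS.divFold (LinEDS.rowZ μ)).sum = 0
      rw [evalE5_evalZ_list_sum]
      refine List.sum_eq_zero fun x hx => ?_
      obtain ⟨μ, hμ, rfl⟩ := List.mem_map.mp hx
      exact hev1 μ (hvalid i μ hμ)
    -- the common finite set of words: column words and Hoffman words
    let Wc : Finset (List Bool) := ((LinEDS.cols k).map (LinEDS.wordOfCode k)).toFinset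
    let Wh : Finset (List Bool) := T.image MZV.binaryWord
    have hsupp1 : ∀ μ, LinEDS.validName k μ = true →
        (LinEDS.divFold (LinEDS.rowZ μ)).support ⊆ Wc ∪ Wh := by
      intro μ hμ w hw
      obtain ⟨hwl, hwh, hwlast⟩ := (stub_rowBits_parity k _ hμ).2.2 w hw
      have hne : w ≠ [] := by rintro rfl; simp at hwh
      -- admissible code
      have hcodelt : LinEDS.code w < 2 ^ (k - 1) := by
        rw [List.eq_cons_of_mem_head? hwh, code_cons]
        simp only [Bool.toNat_false, zero_mul, zero_add]
        have := code_lt w.tail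
        rwa [List.length_tail, hwl] at this
      have hcodeodd : LinEDS.code w % 2 = 1 := by
        have h0 : (LinEDS.code w).testBit 0 = true := by
          rw [testBit_code]
          obtain ⟨w', hw'⟩ := List.getLast?_eq_some_iff.mp hwlast
          rw [hw']; simp
        simpa using h0
      have hww : LinEDS.wordOfCode k (LinEDS.code w) = w := by rw [← hwl, wordOfCode_code]
      by_cases hcw : LinEDS.code w ∈ LinEDS.cols k
      · exact Finset.mem_union_left _ (List.mem_toFinset.mpr
          (List.mem_map.mpr ⟨_, hcw, hww⟩))
      · have : ∃ t, MZV.IsHoffman t ∧ MZV.binaryWord t = LinEDS.wordOfCode k (LinEDS.code w) := by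
          by_contra hno
          exact hcw ((hcols _).mpr ⟨hcodelt, hcodeodd, hno⟩)
        obtain ⟨t, ht, htw⟩ := this
        rw [hww] at htw
        refine Finset.mem_union_right _ (Finset.mem_image.mpr ⟨t, List.mem_toFinset.mpr ?_, htw⟩)
        refine (hhof t).mpr ⟨ht, ?_⟩
        have hpos : ∀ i ∈ t, 1 ≤ i := fun i hi => by rcases ht i hi with rfl | rfl <;> omega
        rw [← MZV.length_binaryWord hpos, htw, hwl]
    have hsupp : ∀ i, (g i).support ⊆ Wc ∪ Wh := fun i =>
      oddDetSumG_support_list_sum_subset _ fun f hf => by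
        obtain ⟨μ, hμ, rfl⟩ := List.mem_map.mp hf
        exact hsupp1 μ (hvalid i μ hμ)
    have hdisj : Disjoint Wc Wh := by
      rw [Finset.disjoint_left]
      intro w hwc hwh
      obtain ⟨c, hc, rfl⟩ := List.mem_map.mp (List.mem_toFinset.mp hwc)
      obtain ⟨t, ht, htw⟩ := Finset.mem_image.mp hwh
      exact ((hcols c).mp hc).2.2 ⟨t, ((hhof t).mp (List.mem_toFinset.mp ht)).1, htw⟩
    -- evaluation of each grouped row as a sum over the common set, with rational scalars
    have hevsum : ∀ i, LinEDS.evalZ φ (g i) = ∑ w ∈ Wc ∪ Wh, ((g i w : ℤ) : ℚ) • φ w := by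
      intro i
      unfold LinEDS.evalZ
      refine (Finsupp.sum_of_support_subset (g i) (hsupp i) (fun w n => n • φ w)
        (fun w _ => zero_smul ℤ (φ w))).trans ?_
      exact Finset.sum_congr rfl fun w _ => (Int.cast_smul_eq_zsmul ℚ _ _).symm
    -- combine with the rational coefficients `l`
    have hzero : ∑ w ∈ Wc ∪ Wh, coef w • φ w = 0 := by
      have : ∑ i, l i • LinEDS.evalZ φ (g i) = 0 := Finset.sum_eq_zero fun i _ => by
        rw [hev i, smul_zero]
      rw [← this]
      simp_rw [hevsum, Finset.smul_sum, smul_smul]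
      rw [Finset.sum_comm]
      exact Finset.sum_congr rfl fun w _ => by rw [← Finset.sum_smul]
    rw [Finset.sum_union hdisj] at hzero
    -- the column part is `φ (bw s)`
    have hcolpart : ∑ w ∈ Wc, coef w • φ w = φ (MZV.binaryWord (a :: s')) := by
      have hcodeinj : ∀ x ∈ LinEDS.cols k, ∀ y ∈ LinEDS.cols k,
          LinEDS.wordOfCode k x = LinEDS.wordOfCode k y → x = y := by
        intro x hx y hy hxy
        have hx' := ((hcols x).mp hx).1
        have hy' := ((hcols y).mp hy).1
        have := congrArg LinEDS.code hxy
        rwa [code_wordOfCode (lt_of_lt_of_le hx' (Nat.pow_le_pow_right (by norm_num) (by omega))),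
          code_wordOfCode (lt_of_lt_of_le hy' (Nat.pow_le_pow_right (by norm_num) (by omega)))] at this
      have hWc : Wc = (LinEDS.cols k).toFinset.image (LinEDS.wordOfCode k) := by
        ext w; simp [Wc, List.mem_toFinset]
      rw [hWc, Finset.sum_image (fun x hx y hy h => hcodeinj x (List.mem_toFinset.mp hx) y
        (List.mem_toFinset.mp hy) h)]
      rw [Finset.sum_congr rfl (g := fun c => if c = c₀ then φ (LinEDS.wordOfCode k c₀) else 0)
        (fun c hc => by
          rw [hcoef_cols c (List.mem_toFinset.mp hc)]
          by_cases h : c = c₀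
          · subst h; simp
          · simp [h]),
        Finset.sum_ite_eq', if_pos (List.mem_toFinset.mpr hc₀col), hwc₀]
    -- the Hoffman part is the `b`-sum
    have hhofpart : ∑ w ∈ Wh, coef w • φ w = ∑ t ∈ T, coef (MZV.binaryWord t) • φ (MZV.binaryWord t) := by
      refine Finset.sum_image fun t ht t' ht' h => ?_
      have hpos : ∀ i ∈ t, 1 ≤ i := fun i hi => by
        rcases ((hhof t).mp (List.mem_toFinset.mp ht)).1 i hi with rfl | rfl <;> omega
      have hpos' : ∀ i ∈ t', 1 ≤ i := fun i hi => by
        rcases ((hhof t').mp (List.mem_toFinset.mp ht')).1 i hi with rfl | rfl <;> omega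
      have := congrArg MZV.ofBinaryWord h
      rwa [MZV.ofBinaryWord_binaryWord hpos, MZV.ofBinaryWord_binaryWord hpos'] at this
    rw [hcolpart, hhofpart] at hzero
    rw [masterE10_sum_finset_single T _ (fun t q => q • φ (MZV.binaryWord t)) (fun t => zero_smul ℚ _)
      (fun t a b => add_smul a b _)]
    simp_rw [neg_smul, Finset.sum_neg_distrib]
    rw [eq_neg_iff_add_eq_zero, hzero]

end Summit.KontsevichZagierPeriods.LinRedNormalForm.HoffmanSpanInKZ
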